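import Literature.Computability.Cryptography.ChenQuantumLWEProductProofs

/-!
# Fourier sampling of Chen's chirped coset state `|φ8.b⟩`: flat spectrum, the oracle kick, and the hyperplane law

REPRODUCTION / ANALYSIS OF A CLAIMED RESULT UNDER ADJUDICATION (withdrawn): Yilei Chen, *Quantum
Algorithms for Lattice Problems*, IACR ePrint 2024/555, version of 2024-04-18 [ChenQuantumLattice2024]
(the version carrying the author's inline withdrawal notes; see `ChenQuantumLWESteps.lean`), Step 9
(§3.5.9, pp. 34–38) acting on the state `|φ8.b⟩ = Σ_{j ∈ ℤ_P} e(-j²/P) |2D²j·b + v′ mod N⟩` (p. 35),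
`P = p₁Q = M/(2D²)`, `N = D²P = M/2`.  Bundle `papers/QuantumAdvantage/lwe-quantum-autopsy/` (Part 2,
`REPAIR-CENSUS.md` §8), companion of `ChenQuantumLWEProductProofs.lean` (Part 1), which records that the
QFT consequences were NOT formalised there; this file formalises them for `|φ8.b⟩`.
HONEST FRAMING: kernel-checked THEOREMS (exact Fourier laws) about states occurring in a WITHDRAWN
algorithm and about the one repair that provably works GIVEN AN ORACLE — a certificate and a precise
negative result, NOT summit progress, no cryptanalytic claim in either direction, no new algorithm.

Contents (Chen's conventions: `QFT` with kernel `e^{-2πi⟨z,u⟩/N}`, Lemma 2.12; kickback `e(g(z))`, Lemma 2.13).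
* Generic layer: `lineKet` (a ket supported on a parametrised family of basis vectors), `qft_lineKet`,
  `kick_lineKet`; the reduction `toP : ℤ_N →+* ℤ_P` and the two-modulus identity
  `ψ_N(k·D²·y) = ψ_P(k·(y mod P))` (`stdAddChar_natCast_mul_sq_mul`).
* `qft_phi8bKet`: `QFT|φ8.b⟩(u) = ψ_N(-⟨v′,u⟩) · Σ_{j∈ℤ_P} ψ_P(-j² - 2⟨b,u mod P⟩·j)` — a quadratic Gauss
  sum with unit leading coefficient for EVERY outcome `u`; hence **T3** `weight_qft_phi8bKet` /
  `Shape.weight_qft_phi8b`: `|QFT|φ8.b⟩(u)|² = P` for all `u` (odd `P`): the spectrum of the un-kicked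
  state is exactly flat (Korobov 1992, Ch. I §3, via `Literature.NumberTheory.GaussSums`).
* The ORACLE KICK `oracleKick w0` (Part 1's `chirpCancelExponent` in turns) for a guess `w0` of `v′₀`:
  `kick_phi8bKet` — the chirp becomes the linear phase `ψ_P(2εj + ε²)` with CENTRE ERROR
  `ε(w0) = ((w0 - v′₀) mod P)·(2D²)⁻¹`; `qft_kick_phi8bKet` — **the hyperplane law**
  `QFT(kick|φ8.b⟩)(u) = ψ_P(ε²)ψ_N(-⟨v′,u⟩)·P·[⟨b, u mod P⟩ = ε]`; weights `P²` on the affine hyperplane,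
  `0` off it (`weight_qft_kick_phi8bKet`, `qft_kick_ne_zero_iff`); `centreError_eq_zero_iff`:
  `ε = 0 ↔ w0 ≡ v′₀ (mod P)`; `oracleKick_congr`: the kick depends on `w0 mod P` only — beyond Step 8's
  `v′₀ mod D²p₁` (Lemma 3.13) the missing datum is `v′₀ mod Q` (cf. `instA_step8_residue_insufficient`).
  For admissible shapes: **G1** `Shape.weight_qft_kick_phi8b_of_correct` (right guess mod `P` ⇒ every
  outcome satisfies `⟨b,u⟩ ≡ 0 (mod P)`), **T5** `Shape.weight_qft_kick_phi8b_of_wrong` (wrong guess ⇒ NO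
  outcome satisfies it: all weight on the parallel hyperplane `⟨b,u⟩ ≡ ε ≠ 0`).
* `isProduct_qft` / `weight_qft_product`: `QFT_{ℤ_mⁿ⁺¹}` maps product states (coordinate 0 | rest) to
  product states, so the Fourier sample of any product state has a product law — with Part 1's
  `Shape.phi8f_isProduct` this is the structural half of **T2** (`u[1..n]` independent of `u₀` whatever
  replaces (9.e)–(9.g) on coordinate 0); the value `Pr[eq. (41)] = 1/Q` is the bundle's exact-arithmetic
  check (`numerics/b2b-lwe-2/`), not formalised.
* `Shape.phi8b_eq_phi8bKet`: the `Steps` rendering `Shape.phi8b` (sum over `j ∈ [0,P)` as printed) is the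
  same state, so every law above holds for `Shape.phi8b` under `Shape.Admissible`.

References: [ChenQuantumLattice2024] as above; [Korobov1992] N. M. Korobov, *Exponential Sums and their
Applications*, Kluwer 1992, Ch. I §3 (quadratic Gauss sums; used through
`Literature.NumberTheory.GaussSums.norm_sq_sum_stdAddChar_quadratic`).
-/

namespace Literature.Computability.Cryptography.Chen2024

open scoped BigOperators

/-! ### Generic Fourier layer: kets supported on a parametrised family of basis vectors -/

/-- A ket supported on a parametrised family of basis vectors `pt j` with coefficients `c j`
(coefficients of coinciding points add up). [folklore] -/
noncomputable def lineKet {ι : Type*} [Fintype ι] {k m : ℕ} (pt : ι → (Fin k → ZMod m))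
    (c : ι → ℂ) : Ket k m :=
  fun z => ∑ j, if z = pt j then c j else 0

/-- A chirped line's ket is a `lineKet`. [folklore] -/
theorem ChirpedLine.ket_eq_lineKet {n : ℕ} (L : ChirpedLine n) :
    L.ket = lineKet L.pt (fun j => e (((L.θ j).val : ℚ) / L.P)) := rfl

/-- The `QFT` phase `e(-⟨z,u⟩/m)` is the standard additive character of `ZMod m` at `-⟨z,u⟩`.
[folklore] -/
theorem qft_phase_eq_stdAddChar {k m : ℕ} [NeZero m] (z u : Fin k → ZMod m) :
    e (-(((∑ i, (z i).val * (u i).val : ℕ) : ℚ) / m)) = ZMod.stdAddChar (-(∑ i, z i * u i)) := by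
  rw [show (-(((∑ i, (z i).val * (u i).val : ℕ) : ℚ) / m))
      = (((-((∑ i, (z i).val * (u i).val : ℕ) : ℤ)) : ℤ) : ℚ) / m by push_cast; ring,
    e_intCast_div_eq_stdAddChar]
  congr 1
  push_cast
  simp

/-- `QFT` of a line ket: one term per parameter value, `Σ_j c_j · ψ_m(-⟨pt j, u⟩)`. [folklore] -/
theorem qft_lineKet {ι : Type*} [Fintype ι] {k m : ℕ} [NeZero m] (pt : ι → (Fin k → ZMod m))
    (c : ι → ℂ) (u : Fin k → ZMod m) :
    qft (lineKet pt c) u = ∑ j, c j * ZMod.stdAddChar (-(∑ i, pt j i * u i)) := by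
  unfold qft lineKet
  simp_rw [Finset.sum_mul, ite_mul, zero_mul]
  rw [Finset.sum_comm]
  refine Finset.sum_congr rfl fun j _ => ?_
  simp only [Finset.sum_ite_eq', Finset.mem_univ, if_true, qft_phase_eq_stdAddChar]

/-- Phase kickback acts on the coefficients of a line ket. [folklore] -/
theorem kick_lineKet {ι : Type*} [Fintype ι] {k m : ℕ} (pt : ι → (Fin k → ZMod m)) (c : ι → ℂ)
    (g : (Fin k → ZMod m) → ℚ) :
    kick g (lineKet pt c) = lineKet pt (fun j => c j * e (g (pt j))) := by
  funext z
  unfold kick lineKet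
  rw [Finset.sum_mul]
  refine Finset.sum_congr rfl fun j _ => ?_
  split_ifs with h
  · rw [h]
  · rw [zero_mul]

/-! ### The reduction `ZMod N → ZMod P` for `N = D²P`, and the two-modulus character identity -/

section TwoModuli
variable (D P : ℕ+)

/-- `P ∣ N` for `N = D·D·P`. [folklore] -/
theorem P_dvd_N : ((P : ℕ+) : ℕ) ∣ ((D * D * P : ℕ+) : ℕ) :=
  ⟨D * D, by push_cast; ring⟩

/-- The reduction map `ZMod N →+* ZMod P`, `N = D²P` (reading a register modulo `P = M/(2D²)`).
[folklore] -/
def toP : ZMod (D * D * P : ℕ+) →+* ZMod (P : ℕ+) :=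
  ZMod.castHom (P_dvd_N D P) (ZMod (P : ℕ+))

/-- **Two-modulus identity.** `ψ_N(k·D²·y) = ψ_P(k·(y mod P))` for `N = D²P`: a phase `e(D²t/N)` is the
phase `e(t/P)` (the `ℕ`-typed cousin for `D ∣ N` is `Literature.NumberTheory.Sieve.DFI1995.stdAddChar_mul_div`;
restated in the `ℕ+`/`D²` typing of `ChirpedLine` so that this file does not import the sieve library).
[folklore] -/
theorem stdAddChar_natCast_mul_sq_mul (k : ℕ) (y : ZMod (D * D * P : ℕ+)) :
    ZMod.stdAddChar ((k : ZMod (D * D * P : ℕ+)) * ((D : ℕ) : ZMod (D * D * P : ℕ+)) ^ 2 * y)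
      = ZMod.stdAddChar ((k : ZMod (P : ℕ+)) * toP D P y) := by
  obtain ⟨t, rfl⟩ : ∃ t : ℕ, (t : ZMod (D * D * P : ℕ+)) = y := ⟨y.val, ZMod.natCast_zmod_val y⟩
  have h1 : ((k : ZMod (D * D * P : ℕ+)) * ((D : ℕ) : ZMod (D * D * P : ℕ+)) ^ 2
        * ((t : ℕ) : ZMod (D * D * P : ℕ+)))
      = ((((k : ℤ) * ((D : ℕ) : ℤ) ^ 2 * ((t : ℕ) : ℤ) : ℤ)) : ZMod (D * D * P : ℕ+)) := by
    simp only [Int.cast_mul, Int.cast_pow, Int.cast_natCast]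
  have h2 : ((k : ZMod (P : ℕ+)) * toP D P ((t : ℕ) : ZMod (D * D * P : ℕ+)))
      = ((((k : ℤ) * ((t : ℕ) : ℤ) : ℤ)) : ZMod (P : ℕ+)) := by
    rw [map_natCast]; simp only [Int.cast_mul, Int.cast_natCast]
  rw [h1, h2, ZMod.stdAddChar_coe, ZMod.stdAddChar_coe]
  congr 1
  have hD : ((D : ℕ) : ℂ) ≠ 0 := by exact_mod_cast (PNat.ne_zero D)
  have hP : ((P : ℕ) : ℂ) ≠ 0 := by exact_mod_cast (PNat.ne_zero P)
  push_cast
  field_simp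

end TwoModuli

/-! ### `|φ8.b⟩` over clean index types: points, ket, hyperplane functional, offset phase -/

/-- `ℤ_P` with `P = p₁Q` (the period of the line parameter `j`). [folklore] -/
abbrev ZP (p₁ Q : ℕ+) : Type := ZMod ((p₁ * Q : ℕ+) : ℕ)

/-- `ℤ_N` with `N = D²P` (the register modulus in Step 9). [folklore] -/
abbrev ZN (D p₁ Q : ℕ+) : Type := ZMod ((D * D * (p₁ * Q) : ℕ+) : ℕ)

section Phi8b

variable (n : ℕ) (D p₁ Q : ℕ+) (b v' : Fin (n + 1) → ℤ)

/-- The basis vector of `|φ8.b⟩` at parameter `j ∈ ℤ_P`: `2D²j·b + v′ mod N` (same expression as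
`phi8fLine.pt`). [cite: ChenQuantumLattice2024, §3.5.9 p. 35] -/
def ptB (j : ZP p₁ Q) : Fin (n + 1) → ZN D p₁ Q :=
  fun i => ((2 * (D : ℤ) ^ 2 * (j.val : ℤ) * b i + v' i : ℤ) : ZN D p₁ Q)

/-- `|φ8.b⟩ = Σ_{j ∈ ℤ_P} ψ_P(-j²) |2D²j·b + v′ mod N⟩` as a `lineKet` over `ℤ_P`.
[cite: ChenQuantumLattice2024, §3.5.9 p. 35] -/
noncomputable def phi8bKet : Ket (n + 1) ((D * D * (p₁ * Q) : ℕ+) : ℕ) :=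
  lineKet (ptB n D p₁ Q b v') (fun j => (ZMod.stdAddChar (-(j ^ 2) : ZP p₁ Q) : ℂ))

/-- The `ChirpedLine` ket `(phi8bLine …).ket` of `ChenQuantumLWEProductState` IS `phi8bKet`.
[cite: ChenQuantumLattice2024, §3.5.9 p. 35] -/
theorem phi8bLine_ket : (phi8bLine n D p₁ Q b v').ket = phi8bKet n D p₁ Q b v' := by
  funext z
  unfold ChirpedLine.ket phi8bKet lineKet
  refine Finset.sum_congr rfl fun j _ => ?_
  rw [e_val_div_eq_stdAddChar]
  rfl

/-- The hyperplane functional of the Fourier side: `lineFun u = ⟨b, u mod P⟩ = Σ_i b_i·(u_i mod P) ∈ ℤ_P`.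
[cite: ChenQuantumLattice2024, eq. (41) p. 38 (shape of the linear relation)] -/
def lineFun (u : Fin (n + 1) → ZN D p₁ Q) : ZP p₁ Q :=
  ∑ i, ((b i : ℤ) : ZP p₁ Q) * toP D (p₁ * Q) (u i)

/-- The offset phase exponent `⟨v′, u⟩ ∈ ℤ_N` (a global phase per outcome `u`; it never affects a Born
weight). [folklore] -/
def offsetFun (u : Fin (n + 1) → ZN D p₁ Q) : ZN D p₁ Q := ∑ i, ((v' i : ℤ) : ZN D p₁ Q) * u i

/-- Coordinates of `ptB j` with the casts pushed in. [folklore] -/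
theorem ptB_apply (j : ZP p₁ Q) (i : Fin (n + 1)) :
    ptB n D p₁ Q b v' j i
      = 2 * ((D : ℕ) : ZN D p₁ Q) ^ 2 * ((j.val : ℕ) : ZN D p₁ Q) * ((b i : ℤ) : ZN D p₁ Q)
        + ((v' i : ℤ) : ZN D p₁ Q) := by
  simp only [ptB, Int.cast_add, Int.cast_mul, Int.cast_pow, Int.cast_ofNat, Int.cast_natCast]

/-- `⟨ptB j, u⟩ = j·D²·(2⟨b,u⟩) + ⟨v′,u⟩` in `ℤ_N`. [folklore] -/
theorem ptB_inner (j : ZP p₁ Q) (u : Fin (n + 1) → ZN D p₁ Q) :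
    ∑ i, ptB n D p₁ Q b v' j i * u i
      = ((j.val : ℕ) : ZN D p₁ Q) * ((D : ℕ) : ZN D p₁ Q) ^ 2 * (2 * ∑ i, ((b i : ℤ) : ZN D p₁ Q) * u i)
        + offsetFun n D p₁ Q v' u := by
  simp_rw [ptB_apply]
  rw [offsetFun, Finset.mul_sum, Finset.mul_sum, ← Finset.sum_add_distrib]
  refine Finset.sum_congr rfl fun i _ => ?_
  ring

/-- Reduction of `2⟨b,u⟩ ∈ ℤ_N` modulo `P` is `2·lineFun u`. [folklore] -/
theorem toP_two_mul_sum (u : Fin (n + 1) → ZN D p₁ Q) :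
    toP D (p₁ * Q) (2 * ∑ i, ((b i : ℤ) : ZN D p₁ Q) * u i) = 2 * lineFun n D p₁ Q b u := by
  simp only [lineFun, map_mul, map_sum, map_intCast, map_ofNat]

/-- The QFT phase of one term of `|φ8.b⟩`: `ψ_N(-⟨ptB j,u⟩) = ψ_P(j·(-2·lineFun u)) · ψ_N(-⟨v′,u⟩)`.
[folklore] -/
theorem stdAddChar_neg_inner (j : ZP p₁ Q) (u : Fin (n + 1) → ZN D p₁ Q) :
    ZMod.stdAddChar (-(∑ i, ptB n D p₁ Q b v' j i * u i))
      = ZMod.stdAddChar (j * (-(2 * lineFun n D p₁ Q b u)))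
        * ZMod.stdAddChar (-offsetFun n D p₁ Q v' u) := by
  rw [ptB_inner, neg_add, AddChar.map_add_eq_mul]
  congr 1
  rw [show -(((j.val : ℕ) : ZN D p₁ Q) * ((D : ℕ) : ZN D p₁ Q) ^ 2
          * (2 * ∑ i, ((b i : ℤ) : ZN D p₁ Q) * u i))
      = ((j.val : ℕ) : ZN D p₁ Q) * ((D : ℕ) : ZN D p₁ Q) ^ 2
          * (-(2 * ∑ i, ((b i : ℤ) : ZN D p₁ Q) * u i)) by ring,
    stdAddChar_natCast_mul_sq_mul, ZMod.natCast_zmod_val, map_neg, toP_two_mul_sum]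

/-- **`QFT|φ8.b⟩` in closed form**: `ψ_N(-⟨v′,u⟩) · Σ_{j ∈ ℤ_P} ψ_P(-j² - 2·lineFun(u)·j)` — a quadratic
Gauss sum with unit leading coefficient for EVERY outcome `u`. [cite: ChenQuantumLattice2024, §3.5.9 p. 35;
Korobov1992, Ch. I §3] -/
theorem qft_phi8bKet (u : Fin (n + 1) → ZN D p₁ Q) :
    qft (phi8bKet n D p₁ Q b v') u
      = ZMod.stdAddChar (-offsetFun n D p₁ Q v' u)
        * ∑ j : ZP p₁ Q, ZMod.stdAddChar ((-1) * j ^ 2 + (-(2 * lineFun n D p₁ Q b u)) * j) := by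
  rw [phi8bKet, qft_lineKet, Finset.mul_sum]
  refine Finset.sum_congr rfl fun j _ => ?_
  rw [stdAddChar_neg_inner, ← mul_assoc, ← AddChar.map_add_eq_mul, mul_comm]
  congr 2
  ring

/-- **T3 (flat spectrum).** For odd `P = p₁Q`, the Fourier spectrum of `|φ8.b⟩` is EXACTLY flat:
`|QFT|φ8.b⟩(u)|² = P` for every `u ∈ ℤ_N^{n+1}`, whatever `b` and the unknown offset `v′` are — measuring
`|φ8.b⟩` in the Fourier basis without first cancelling the chirp `e(-j²/P)` returns a uniformly random `u`
and reveals nothing (`REPAIR-CENSUS.md` T3: every "skip / reorder the kick" variant is void).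
[cite: ChenQuantumLattice2024, §3.5.9 p. 35; Korobov1992, Ch. I §3 Thm 3] -/
theorem weight_qft_phi8bKet (hP : Odd ((p₁ * Q : ℕ+) : ℕ)) (u : Fin (n + 1) → ZN D p₁ Q) :
    weight (qft (phi8bKet n D p₁ Q b v')) u = ((p₁ * Q : ℕ+) : ℕ) := by
  rw [weight, qft_phi8bKet, norm_mul, mul_pow, ZMod.stdAddChar_apply, Circle.norm_coe, one_pow, one_mul]
  exact Literature.NumberTheory.GaussSums.norm_sq_sum_stdAddChar_quadratic _ hP (-1) _ isUnit_one.neg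

end Phi8b

/-! ### The chirp-cancelling kick: what an oracle for `v′₀ mod P` buys (G1), what a wrong guess gives (T5) -/

section Kick

variable (n : ℕ) (D p₁ Q : ℕ+) (b v' : Fin (n + 1) → ℤ)

/-- `(2D²)⁻¹ mod P` (an inverse when `gcd(2D, P) = 1`, as under Cond. C.3).
[cite: ChenQuantumLattice2024, Cond. C.3 p. 18] -/
def inv2D2 : ZP p₁ Q := (((2 * D * D : ℕ) : ZP p₁ Q))⁻¹

/-- `toP` is the `val`-cast reduction used by `chirpCancelExponent`. [folklore] -/
theorem toP_eq_natCast_val (x : ZN D p₁ Q) : toP D (p₁ * Q) x = ((x.val : ℕ) : ZP p₁ Q) := by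
  rw [toP, ZMod.castHom_apply, ZMod.cast_eq_val]

/-- The ORACLE KICK for a guess `w0 ∈ ℤ_N` of the unknown offset `v′₀`: the phase kickback (Lemma 2.13)
by `c(z₀)²/P` turns, `c(z₀) = ((w0 - z₀) mod P)·(2D²)⁻¹ ∈ ℤ_P` — exactly Part 1's `chirpCancelExponent`
read in turns.  With `w0 = v′₀` it cancels the chirp `e(-j²/P)` of `|φ8.b⟩` (p. 22: "learn one
coordinate of `v′`"). [cite: ChenQuantumLattice2024, Lemma 2.13 p. 13, §3.5 p. 22, §3.5.9 p. 35] -/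
def oracleKick (w0 : ZN D p₁ Q) : (Fin (n + 1) → ZN D p₁ Q) → ℚ :=
  fun z => (((chirpCancelExponent (p₁ * Q) (D * D * (p₁ * Q)) (inv2D2 D p₁ Q) w0 (z 0)).val : ℚ)
    / ((p₁ * Q : ℕ+) : ℕ))

/-- `chirpCancelExponent` through the ring map `toP`. [folklore] -/
theorem chirpCancelExponent_eq (w0 z0 : ZN D p₁ Q) :
    chirpCancelExponent (p₁ * Q) (D * D * (p₁ * Q)) (inv2D2 D p₁ Q) w0 z0
      = (toP D (p₁ * Q) (w0 - z0) * inv2D2 D p₁ Q) ^ 2 := by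
  rw [chirpCancelExponent, toP_eq_natCast_val]

/-- The oracle kick depends on the guess `w0` only through `w0 mod P` (so, given Lemma 3.13's
`v′₀ mod D²p₁`, the information it needs beyond Step 8 is `v′₀ mod Q`, cf. `instA_step8_residue_insufficient`).
[cite: ChenQuantumLattice2024, Lemma 3.13 p. 32 and §3.5.9 p. 35] -/
theorem oracleKick_congr {w0 w0' : ZN D p₁ Q} (h : toP D (p₁ * Q) w0 = toP D (p₁ * Q) w0') :
    oracleKick n D p₁ Q w0 = oracleKick n D p₁ Q w0' := by
  funext z
  simp only [oracleKick, chirpCancelExponent_eq, map_sub, h]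

/-- The CENTRE ERROR of a guess: `ε(w0) = ((w0 - v′₀) mod P)·(2D²)⁻¹ ∈ ℤ_P`; `ε = 0` iff the guess is
right modulo `P` (`centreError_eq_zero_iff`). [folklore] -/
def centreError (w0 : ZN D p₁ Q) : ZP p₁ Q :=
  toP D (p₁ * Q) (w0 - ((v' 0 : ℤ) : ZN D p₁ Q)) * inv2D2 D p₁ Q

/-- On the support of `|φ8.b⟩` the kick index is `j + ε`: `((w0 - (ptB j)₀) mod P)·(2D²)⁻¹ = j + ε(w0)`
(`b₀ = -1`, `2D²` invertible mod `P`). [cite: ChenQuantumLattice2024, eq. (12) p. 17 (`b₀ = -1`), §3.5.9 p. 35] -/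
theorem kickIndex (hb : b 0 = -1) (hunit : IsUnit ((2 * D * D : ℕ) : ZP p₁ Q)) (w0 : ZN D p₁ Q)
    (j : ZP p₁ Q) :
    toP D (p₁ * Q) (w0 - ptB n D p₁ Q b v' j 0) * inv2D2 D p₁ Q = j + centreError n D p₁ Q v' w0 := by
  have hpt : ptB n D p₁ Q b v' j 0
      = ((v' 0 : ℤ) : ZN D p₁ Q) - ((j.val : ℕ) : ZN D p₁ Q) * ((2 * D * D : ℕ) : ZN D p₁ Q) := by
    rw [ptB_apply, hb]
    simp only [Int.cast_neg, Int.cast_one, Nat.cast_mul, Nat.cast_ofNat]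
    ring
  rw [hpt, centreError,
    show w0 - (((v' 0 : ℤ) : ZN D p₁ Q) - ((j.val : ℕ) : ZN D p₁ Q) * ((2 * D * D : ℕ) : ZN D p₁ Q))
      = (w0 - ((v' 0 : ℤ) : ZN D p₁ Q)) + ((j.val : ℕ) : ZN D p₁ Q) * ((2 * D * D : ℕ) : ZN D p₁ Q)
      by ring,
    map_add, map_mul, map_natCast, map_natCast, ZMod.natCast_zmod_val]
  have hc : ((2 * D * D : ℕ) : ZP p₁ Q) * inv2D2 D p₁ Q = 1 := by
    rw [inv2D2]; exact ZMod.mul_inv_of_unit _ hunit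
  linear_combination (j : ZP p₁ Q) * hc

/-- **The kicked state.** After the oracle kick with guess `w0`, `|φ8.b⟩` is the SAME line with
coefficients `ψ_P(2εj + ε²)`: the chirp is replaced by a LINEAR phase of slope `2ε(w0)` (zero iff the
guess is right mod `P`). [cite: ChenQuantumLattice2024, §3.5 p. 22 and §3.5.9 p. 35] -/
theorem kick_phi8bKet (hb : b 0 = -1) (hunit : IsUnit ((2 * D * D : ℕ) : ZP p₁ Q)) (w0 : ZN D p₁ Q) :
    kick (oracleKick n D p₁ Q w0) (phi8bKet n D p₁ Q b v')
      = lineKet (ptB n D p₁ Q b v') (fun j =>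
          (ZMod.stdAddChar
            (2 * centreError n D p₁ Q v' w0 * j + centreError n D p₁ Q v' w0 ^ 2 : ZP p₁ Q) : ℂ)) := by
  rw [phi8bKet, kick_lineKet]
  congr 1
  funext j
  simp only [oracleKick]
  rw [e_val_div_eq_stdAddChar, chirpCancelExponent_eq, kickIndex n D p₁ Q b v' hb hunit,
    ← AddChar.map_add_eq_mul]
  congr 1
  ring

/-- A value of the standard additive character is non-zero. [folklore] -/
theorem stdAddChar_ne_zero {m : ℕ} [NeZero m] (x : ZMod m) : (ZMod.stdAddChar x : ℂ) ≠ 0 := by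
  intro h0
  have h1 : ‖(ZMod.stdAddChar x : ℂ)‖ = 1 := by rw [ZMod.stdAddChar_apply, Circle.norm_coe]
  rw [h0, norm_zero] at h1
  exact zero_ne_one h1

/-- **QFT of the kicked state (the hyperplane law).** For odd `P`, `b₀ = -1`, `gcd(2D,P) = 1`:
`QFT(kick_{w0}|φ8.b⟩)(u) = ψ_P(ε²)·ψ_N(-⟨v′,u⟩)·P·[lineFun u = ε(w0)]` — the outcome `u` lies EXACTLY on
the affine hyperplane `⟨b, u mod P⟩ = ε(w0)` of `ℤ_P`, with equal weights.  `ε = 0` (right guess mod `P`,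
G1): the homogeneous relation `⟨b,u⟩ ≡ 0 (mod P)` with certainty.  `ε ≠ 0` (wrong guess, T5): the SAME
experiment returns the parallel hyperplane shifted by the unknown `ε`, indistinguishable sample by sample.
[cite: ChenQuantumLattice2024, §3.5.9 pp. 35–38, eq. (41) p. 38] -/
theorem qft_kick_phi8bKet (hP : Odd ((p₁ * Q : ℕ+) : ℕ)) (hb : b 0 = -1)
    (hunit : IsUnit ((2 * D * D : ℕ) : ZP p₁ Q)) (w0 : ZN D p₁ Q) (u : Fin (n + 1) → ZN D p₁ Q) :
    qft (kick (oracleKick n D p₁ Q w0) (phi8bKet n D p₁ Q b v')) u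
      = ZMod.stdAddChar (centreError n D p₁ Q v' w0 ^ 2)
        * ZMod.stdAddChar (-offsetFun n D p₁ Q v' u)
        * (if lineFun n D p₁ Q b u = centreError n D p₁ Q v' w0
            then ((((p₁ * Q : ℕ+) : ℕ) : ℂ)) else 0) := by
  rw [kick_phi8bKet n D p₁ Q b v' hb hunit, qft_lineKet]
  simp_rw [stdAddChar_neg_inner]
  have hterm : ∀ j : ZP p₁ Q,
      (ZMod.stdAddChar (2 * centreError n D p₁ Q v' w0 * j + centreError n D p₁ Q v' w0 ^ 2) : ℂ)
          * (ZMod.stdAddChar (j * -(2 * lineFun n D p₁ Q b u))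
            * ZMod.stdAddChar (-offsetFun n D p₁ Q v' u))
        = ZMod.stdAddChar (centreError n D p₁ Q v' w0 ^ 2) * ZMod.stdAddChar (-offsetFun n D p₁ Q v' u)
          * ZMod.stdAddChar (j * (2 * (centreError n D p₁ Q v' w0 - lineFun n D p₁ Q b u))) := by
    intro j
    have hpair : (ZMod.stdAddChar (2 * centreError n D p₁ Q v' w0 * j + centreError n D p₁ Q v' w0 ^ 2) : ℂ)
          * ZMod.stdAddChar (j * -(2 * lineFun n D p₁ Q b u))
        = ZMod.stdAddChar (centreError n D p₁ Q v' w0 ^ 2)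
          * ZMod.stdAddChar (j * (2 * (centreError n D p₁ Q v' w0 - lineFun n D p₁ Q b u))) := by
      rw [← AddChar.map_add_eq_mul, ← AddChar.map_add_eq_mul]
      congr 1
      ring
    rw [← mul_assoc, hpair]
    ring
  simp_rw [hterm]
  rw [← Finset.mul_sum, AddChar.sum_mulShift _ (ZMod.isPrimitive_stdAddChar _), ZMod.card, Nat.cast_ite,
    Nat.cast_zero]
  by_cases h : lineFun n D p₁ Q b u = centreError n D p₁ Q v' w0
  · rw [if_pos h, if_pos (by rw [h, sub_self, mul_zero])]
  · rw [if_neg h, if_neg]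
    intro h2
    apply h
    have h3 := (Literature.NumberTheory.GaussSums.isUnit_two_zmod_of_odd _ hP).mul_right_eq_zero.1 h2
    exact (sub_eq_zero.1 h3).symm

/-- **Born weights after the oracle kick**: `P²` on the hyperplane `lineFun u = ε(w0)`, `0` off it.
[cite: ChenQuantumLattice2024, §3.5.9 pp. 35–38] -/
theorem weight_qft_kick_phi8bKet (hP : Odd ((p₁ * Q : ℕ+) : ℕ)) (hb : b 0 = -1)
    (hunit : IsUnit ((2 * D * D : ℕ) : ZP p₁ Q)) (w0 : ZN D p₁ Q) (u : Fin (n + 1) → ZN D p₁ Q) :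
    weight (qft (kick (oracleKick n D p₁ Q w0) (phi8bKet n D p₁ Q b v'))) u
      = if lineFun n D p₁ Q b u = centreError n D p₁ Q v' w0
        then ((((p₁ * Q : ℕ+) : ℕ) : ℝ)) ^ 2 else 0 := by
  rw [weight, qft_kick_phi8bKet n D p₁ Q b v' hP hb hunit]
  split_ifs with h
  · rw [norm_mul, norm_mul, ZMod.stdAddChar_apply, Circle.norm_coe, ZMod.stdAddChar_apply,
      Circle.norm_coe, one_mul, one_mul, Complex.norm_natCast]
  · simp

/-- The support of the Fourier sample after the kick is EXACTLY the hyperplane. [folklore] -/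
theorem qft_kick_ne_zero_iff (hP : Odd ((p₁ * Q : ℕ+) : ℕ)) (hb : b 0 = -1)
    (hunit : IsUnit ((2 * D * D : ℕ) : ZP p₁ Q)) (w0 : ZN D p₁ Q) (u : Fin (n + 1) → ZN D p₁ Q) :
    qft (kick (oracleKick n D p₁ Q w0) (phi8bKet n D p₁ Q b v')) u ≠ 0
      ↔ lineFun n D p₁ Q b u = centreError n D p₁ Q v' w0 := by
  rw [qft_kick_phi8bKet n D p₁ Q b v' hP hb hunit]
  constructor
  · intro hne
    by_contra hc
    exact hne (by rw [if_neg hc, mul_zero])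
  · intro h
    rw [if_pos h]
    exact mul_ne_zero (mul_ne_zero (stdAddChar_ne_zero _) (stdAddChar_ne_zero _))
      (by exact_mod_cast PNat.ne_zero _)

/-- `inv2D2` is a unit. [folklore] -/
theorem isUnit_inv2D2 (hunit : IsUnit ((2 * D * D : ℕ) : ZP p₁ Q)) : IsUnit (inv2D2 D p₁ Q) :=
  IsUnit.of_mul_eq_one ((2 * D * D : ℕ) : ZP p₁ Q) (by rw [inv2D2]; exact ZMod.inv_mul_of_unit _ hunit)

/-- `ε(w0) = 0 ↔ w0 ≡ v′₀ (mod P)`: the kick is the chirp-cancelling one iff the guess is right MODULO `P`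
— the residue Step 8 does not supply beyond `v′₀ mod D²p₁` is `v′₀ mod Q`.
[cite: ChenQuantumLattice2024, Lemma 3.13 p. 32 and §3.5.9 p. 35] -/
theorem centreError_eq_zero_iff (hunit : IsUnit ((2 * D * D : ℕ) : ZP p₁ Q)) (w0 : ZN D p₁ Q) :
    centreError n D p₁ Q v' w0 = 0 ↔ toP D (p₁ * Q) w0 = toP D (p₁ * Q) ((v' 0 : ℤ) : ZN D p₁ Q) := by
  rw [centreError, (isUnit_inv2D2 D p₁ Q hunit).mul_left_eq_zero, map_sub, sub_eq_zero]

end Kick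

/-! ### `QFT_{ℤ_mⁿ⁺¹}` maps product states to product states (the structural half of T2) -/

/-- **Product in, product out.** If an `(n+1)`-register state is a product across
(coordinate 0 | coordinates 1..n), so is its `QFT_{ℤ_mⁿ⁺¹}` — the Fourier kernel `ψ_m(-⟨z,u⟩)` factorises
over the bipartition.  With `Shape.phi8f_isProduct` / `phi8fLine_processed_isProduct`
(`ChenQuantumLWEProductProofs`): whatever coordinate-0 processing replaces Chen's (9.e)–(9.g), if the state
fed to the final QFT is a product across `(0 | 1..n)` then the measured `(u₀, u[1..n])` has a PRODUCT law —
`u[1..n]` is independent of `u₀`, so the correlation that eq. (41) "always" would need is absent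
(`REPAIR-CENSUS.md` T2, structural half; the value `Pr[(41)] = 1/Q` is the bundle's exact-arithmetic
check, not formalised here). [folklore] -/
theorem isProduct_qft {n m : ℕ} [NeZero m] (ψ : Ket (n + 1) m) (h : IsProduct (splitFirst ψ)) :
    IsProduct (splitFirst (qft ψ)) := by
  obtain ⟨a, c, hac⟩ := h
  have hac' : ∀ (x : ZMod m) (y : Fin n → ZMod m), ψ (Fin.cons x y) = a x * c y := fun x y => hac x y
  refine ⟨fun x' => ∑ x : ZMod m, a x * ZMod.stdAddChar (-(x * x')),
    fun y' => ∑ y : Fin n → ZMod m, c y * ZMod.stdAddChar (-(∑ t, y t * y' t)), fun x' y' => ?_⟩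
  show qft ψ (Fin.cons x' y') = _
  unfold qft
  simp_rw [qft_phase_eq_stdAddChar]
  rw [← Fintype.sum_equiv (Fin.consEquiv fun _ => ZMod m)
        (fun p => ψ (Fin.cons p.1 p.2)
          * ZMod.stdAddChar (-(∑ i, (Fin.cons p.1 p.2 : Fin (n + 1) → ZMod m) i
              * (Fin.cons x' y' : Fin (n + 1) → ZMod m) i)))
        _ (fun p => rfl),
    Finset.sum_mul_sum, ← Finset.sum_product']
  refine Finset.sum_congr (by ext p; simp) fun p _ => ?_
  rw [hac', Fin.sum_univ_succ, Fin.cons_zero, Fin.cons_zero]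
  simp only [Fin.cons_succ]
  rw [neg_add, AddChar.map_add_eq_mul]
  ring

/-- Corollary in Born weights: the Fourier sample `(u₀, u[1..n])` of a product state has a product
(i.e. independent) weight function. [folklore] -/
theorem weight_qft_product {n m : ℕ} [NeZero m] (ψ : Ket (n + 1) m) (h : IsProduct (splitFirst ψ)) :
    ∃ (w₁ : ZMod m → ℝ) (w₂ : (Fin n → ZMod m) → ℝ),
      ∀ x' y', weight (qft ψ) (Fin.cons x' y') = w₁ x' * w₂ y' := by
  obtain ⟨a, c, hac⟩ := isProduct_qft ψ h
  refine ⟨fun x' => ‖a x'‖ ^ 2, fun y' => ‖c y'‖ ^ 2, fun x' y' => ?_⟩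
  rw [weight, show qft ψ (Fin.cons x' y') = a x' * c y' from hac x' y', norm_mul, mul_pow]

end Literature.Computability.Cryptography.Chen2024

/-! ### The `Steps` rendering: `Shape.phi8b` is `phi8bKet`, and the laws for every admissible shape -/

namespace Literature.Computability.Cryptography.Chen2024.Shape

open scoped BigOperators

variable (S : Shape)

/-- The `Steps` ket `Shape.phi8b` (sum over `j ∈ [0,P)`, phase `e(-j²/P)`, p. 35 as printed) equals
`phi8bKet` (sum over `j ∈ ℤ_P`, coefficient `ψ_P(-j²)`). [cite: ChenQuantumLattice2024, §3.5.9 p. 35] -/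
theorem phi8b_eq_phi8bKet : S.phi8b = phi8bKet S.n S.D S.p₁ S.Q S.b S.v' := by
  funext z
  show (∑ j ∈ Finset.range (S.P : ℕ), if z = S.pt8b j then e (-((j : ℚ) ^ 2) / S.P) else 0)
    = ∑ j : ZMod ((S.p₁ * S.Q : ℕ+) : ℕ),
        if z = S.pt8b j.val then
          (ZMod.stdAddChar (-(j ^ 2) : ZMod ((S.p₁ * S.Q : ℕ+) : ℕ)) : ℂ)
        else 0
  symm
  refine Finset.sum_nbij' (fun j => j.val) (fun q => (q : ZMod ((S.p₁ * S.Q : ℕ+) : ℕ)))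
    (fun j _ => ?_) (fun q _ => Finset.mem_univ _) (fun j _ => ?_) (fun q hq => ?_) (fun j _ => ?_)
  · exact Finset.mem_range.2 (ZMod.val_lt j)
  · exact ZMod.natCast_zmod_val j
  · exact ZMod.val_cast_of_lt (Finset.mem_range.1 hq)
  · have hphase : (ZMod.stdAddChar (-(j ^ 2) : ZMod ((S.p₁ * S.Q : ℕ+) : ℕ)) : ℂ)
        = e (-((j.val : ℚ) ^ 2) / S.P) := by
      have hq : (-((j.val : ℚ) ^ 2) / ((S.P : ℕ) : ℚ))
          = (((-(((j.val : ℕ) : ℤ) ^ 2) : ℤ) : ℚ) / (((S.p₁ * S.Q : ℕ+) : ℕ) : ℚ)) := by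
        rw [show (S.P : ℕ) = ((S.p₁ * S.Q : ℕ+) : ℕ) from rfl]
        push_cast
        ring
      rw [hq, e_intCast_div_eq_stdAddChar]
      congr 1
      rw [Int.cast_neg, Int.cast_pow, Int.cast_natCast, ZMod.natCast_zmod_val]
    rw [hphase]

/-- `P = p₁Q` is odd for an admissible shape. [cite: ChenQuantumLattice2024, Cond. C.3 p. 18] -/
theorem Admissible.odd_P {S : Shape} (h : S.Admissible) : Odd ((S.p₁ * S.Q : ℕ+) : ℕ) := by
  rw [PNat.mul_coe]
  exact h.odd_p₁.mul h.odd_Q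

/-- `2D²` is invertible modulo `P` for an admissible shape (`P` odd, `gcd(D, p₁) = gcd(D, Q) = 1`).
[cite: ChenQuantumLattice2024, Cond. C.3 p. 18] -/
theorem Admissible.isUnit_twoDD {S : Shape} (h : S.Admissible) :
    IsUnit ((2 * S.D * S.D : ℕ) : ZMod ((S.p₁ * S.Q : ℕ+) : ℕ)) := by
  rw [ZMod.isUnit_iff_coprime, PNat.mul_coe]
  have h2p : Nat.Coprime 2 S.p₁ := Nat.coprime_two_left.2 h.odd_p₁
  have h2Q : Nat.Coprime 2 S.Q := Nat.coprime_two_left.2 h.odd_Q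
  exact Nat.Coprime.mul_right (Nat.Coprime.mul_left (Nat.Coprime.mul_left h2p h.cop_Dp) h.cop_Dp)
    (Nat.Coprime.mul_left (Nat.Coprime.mul_left h2Q h.cop_DQ) h.cop_DQ)

/-- **T3 for every admissible shape**: `|QFT|φ8.b⟩(u)|² = P` for all `u` — the Fourier sample of the
un-kicked `|φ8.b⟩` is uniform on `ℤ_N^{n+1}`. [cite: ChenQuantumLattice2024, §3.5.9 p. 35; Korobov1992, Ch. I §3 Thm 3] -/
theorem weight_qft_phi8b (h : S.Admissible) (u : Fin (S.n + 1) → ZMod S.N) :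
    weight (qft S.phi8b) u = (S.P : ℕ) := by
  rw [phi8b_eq_phi8bKet]
  exact weight_qft_phi8bKet S.n S.D S.p₁ S.Q S.b S.v' h.odd_P u

/-- **G1/T5 for every admissible shape**: after the oracle kick with guess `w0` for `v′₀`, the Fourier
sample `u` has weight `P²` exactly on the hyperplane `⟨b, u mod P⟩ = ε(w0)` and `0` elsewhere.
[cite: ChenQuantumLattice2024, §3.5.9 pp. 35–38] -/
theorem weight_qft_kick_phi8b (h : S.Admissible) (w0 : ZMod S.N) (u : Fin (S.n + 1) → ZMod S.N) :
    weight (qft (kick (oracleKick S.n S.D S.p₁ S.Q w0) S.phi8b)) u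
      = if lineFun S.n S.D S.p₁ S.Q S.b u = centreError S.n S.D S.p₁ S.Q S.v' w0
        then ((S.P : ℕ) : ℝ) ^ 2 else 0 := by
  rw [phi8b_eq_phi8bKet]
  exact weight_qft_kick_phi8bKet S.n S.D S.p₁ S.Q S.b S.v' h.odd_P h.b_head h.isUnit_twoDD w0 u

/-- **G1 (the oracle repair is sound — and only it).** If the guess is right modulo `P`
(`w0 ≡ v′₀ mod P`; Step 8 certifies only `mod D²p₁`), every outcome satisfies the homogeneous relation
`⟨b, u mod P⟩ = 0`, each with weight `P²`. [cite: ChenQuantumLattice2024, §3.5 p. 22, Lemma 3.13 p. 32, §3.5.9 pp. 35–38] -/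
theorem weight_qft_kick_phi8b_of_correct (h : S.Admissible) (w0 : ZMod S.N)
    (hw : toP S.D (S.p₁ * S.Q) w0 = toP S.D (S.p₁ * S.Q) ((S.v' 0 : ℤ) : ZMod S.N))
    (u : Fin (S.n + 1) → ZMod S.N) :
    weight (qft (kick (oracleKick S.n S.D S.p₁ S.Q w0) S.phi8b)) u
      = if lineFun S.n S.D S.p₁ S.Q S.b u = 0 then ((S.P : ℕ) : ℝ) ^ 2 else 0 := by
  rw [weight_qft_kick_phi8b S h,
    (centreError_eq_zero_iff S.n S.D S.p₁ S.Q S.v' h.isUnit_twoDD w0).2 hw]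

/-- **T5 (a wrong guess is a shifted hyperplane, never the right one).** If `w0 ≢ v′₀ (mod P)`, NO
outcome of the experiment satisfies the homogeneous relation `⟨b, u mod P⟩ = 0`: all weight sits on the
parallel hyperplane `⟨b, u mod P⟩ = ε(w0) ≠ 0`. [cite: ChenQuantumLattice2024, §3.5.9 pp. 35–38] -/
theorem weight_qft_kick_phi8b_of_wrong (h : S.Admissible) (w0 : ZMod S.N)
    (hw : toP S.D (S.p₁ * S.Q) w0 ≠ toP S.D (S.p₁ * S.Q) ((S.v' 0 : ℤ) : ZMod S.N))
    (u : Fin (S.n + 1) → ZMod S.N) (hu : lineFun S.n S.D S.p₁ S.Q S.b u = 0) :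
    weight (qft (kick (oracleKick S.n S.D S.p₁ S.Q w0) S.phi8b)) u = 0 := by
  rw [weight_qft_kick_phi8b S h, if_neg]
  rw [hu]
  intro h0
  exact hw ((centreError_eq_zero_iff S.n S.D S.p₁ S.Q S.v' h.isUnit_twoDD w0).1 h0.symm)

end Literature.Computability.Cryptography.Chen2024.Shape
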